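import Literature.Probability.RandomPlanarGeometry.SAWFiniteMemorySymm
import HarnessLib

/-!
# `μ(ℤ²) ≤ 2.689`: the memory-18 Pönitz–Tittmann certificate on normal-form states

Topic `Literature/Probability/RandomPlanarGeometry`. One compiled evaluation of
`FiniteMemory.checkC 18 2689 1000 80` (`SAWFiniteMemorySymm.lean`): the breadth-first search
finds the `336 168` normal forms (orbits under the eight lattice symmetries) of the `2 689 301`
states of the memory-18 automaton of Pönitz–Tittmann (2000) on `ℤ²`, 80 rounds of integer power
iteration propose a weight vector, and the verified checker confirms closure and the
Collatz–Wielandt inequalities for the symmetric weight with ratio `2689/1000` (P–T Table 2,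
`k = 18`: `μ ≤ 2.6880`). By `connectiveConstant_le_of_checkC` this proves **`μ(ℤ²) ≤ 2.689`** (hence `≤ 2.69`),
improving the tree's `μ ≤ 2.695` (`SAWFiniteMemory16.lean`, `k = 16`). The only non-standard
axiom is the `native_decide` auxiliary axiom of `checkC_18` (`Lean.ofReduceBool`), declared to
the gate as `computational`; the evaluation takes ≈ 5 minutes (`336 168` normal forms; measured 333 s). Memory 20 (`2.6832`) would need
≈ 1.9 · 10⁶ normal forms, beyond one kernel evaluation; the printed record is `2.679192495`
(P–T, `k = 22` with further state merging).

## References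

* A. Pönitz, P. Tittmann, *Improved upper bounds for self-avoiding walks in ℤᵈ*, Electron. J.
  Combin. 7 (2000) R21, §3 and Table 2 [PonitzTittmann2000].
-/

namespace Literature.Probability.RandomPlanarGeometry.SAW

/-- The symmetry-reduced memory-18 certificate evaluates to `true` (`336 168` normal forms,
ratio `2.689`). [cite: PonitzTittmann2000, Table 2] -/
theorem FiniteMemory.checkC_18 : FiniteMemory.checkC 18 2689 1000 80 = true := by
  native_decide

/-- **`μ(ℤ²) ≤ 2.689`** (Pönitz–Tittmann 2000, Table 2, `k = 18`: `μ ≤ 2.6880`).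
[cite: PonitzTittmann2000, Table 2] -/
theorem connectiveConstant_le_2689 : connectiveConstant ≤ 2.689 := by
  have h := FiniteMemory.connectiveConstant_le_of_checkC FiniteMemory.checkC_18 (by norm_num)
  have e : ((2689 : ℕ) : ℝ) / ((1000 : ℕ) : ℝ) = 2.689 := by norm_num
  rwa [e] at h

/-- **`μ(ℤ²) ≤ 2.69`**, the round form. [cite: PonitzTittmann2000, Table 2] -/
theorem connectiveConstant_le_269 : connectiveConstant ≤ 2.69 :=
  connectiveConstant_le_2689.trans (by norm_num)

end Literature.Probability.RandomPlanarGeometry.SAW
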